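/-
Copyright (c) 2026. All rights reserved.
Released under Apache 2.0 license as described in the file LICENSE.
Authors: abc-iut cell — author of record abc-iut-L3-d5 (G10 rung 2); filer-of-record abc-iut-w4-d064 (orphan rescue: imports only).
-/
import Literature.AnabelianGeometry.SemiGraphs.TemperedResiduallyFiniteAssembly
import Literature.AnabelianGeometry.SemiGraphs.TemperedPiLevels
import Literature.AnabelianGeometry.SemiGraphs.UniversalCoveringOverHomogeneous
import HarnessLib

/-!
# [SemiAnbd] Prop. 3.6 (iii) DISCHARGED: `π₁^temp(𝒢)` is residually finite

Mochizuki, *Semi-graphs of anabelioids*, Publ. RIMS **42** (2006), §3 Prop. 3.6 (iii) p. 38 and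
its proof p. 39.  We discharge the named fact `ProfiniteSemiGraph.TemperedPiResiduallyFinite`
(`TemperedVerticial.lean`) by instantiating the assembly
`temperedPiResiduallyFinite_of_galoisApproxPt` (`TemperedResiduallyFiniteAssembly.lean`) with the
two outputs of the rung-1 construction of `π₁^temp(𝒢)` (abc-iut-L3-t9): the Galois tower
(`TemperedPiExistence` / `TemperedPiLevels`: its levels are finite, pointed, have fibre-transitive
and — by the Galois-category rigidity `evaluation_injective_of_isConnected` — fibre-rigid
endomorphisms, and split every component of every tempered covering) and the homogeneity of the
`𝒢_{∞,S}` (`UniversalCoveringOverHomogeneous`).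
-/

namespace Literature.AnabelianGeometry.SemiGraphs

namespace ProfiniteSemiGraph

open CategoryTheory CategoryTheory.PreGaloisCategory Literature.AnabelianGeometry.Anabelioids

universe u

variable (𝒢 : ProfiniteSemiGraph.{u})

/-- Endomorphisms of the covering attached to a CONNECTED object `A` of the Galois category `B(𝒢)`
are determined by their value at any one point of any vertex fibre (Galois-category rigidity,
transported along the full functor `ofBObj`). [cite: MochizukiSemiAnbd2006, Prop 3.6 p.38] -/
theorem hrigid_ofBObj_of_isConnected (hc : 𝒢.graph.IsConnected) (A : 𝒢.toAnab.BObj)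
    (hA : letI := SemiGraphOfAnabelioids.galoisCategory_bObj 𝒢.toAnab ⟨hc⟩; PreGaloisCategory.IsConnected A)
    (v : 𝒢.graph.Vertex) (x₀ : ((𝒢.ofBObj.obj A).SV v).obj.V)
    (σ σ' : 𝒢.ofBObj.obj A ⟶ 𝒢.ofBObj.obj A)
    (h : (σ.fV v).hom.hom x₀ = (σ'.fV v).hom.hom x₀) : σ = σ' := by
  letI := SemiGraphOfAnabelioids.galoisCategory_bObj 𝒢.toAnab ⟨hc⟩
  haveI := 𝒢.fiberFunctor_fiberAt hc v
  haveI := hA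
  obtain ⟨τ, rfl⟩ := 𝒢.ofBObj.map_surjective σ
  obtain ⟨τ', rfl⟩ := 𝒢.ofBObj.map_surjective σ'
  exact congrArg _ (evaluation_injective_of_isConnected (𝒢.fiberAt v) A A x₀ h)

variable {𝒢} in
/-- Splitting of the component sub-covering `T.component p` gives splitting of `T` at every point
of the component of `p`. [cite: MochizukiSemiAnbd2006, Def 3.5(ii) p.37] -/
theorem CovObj.splitsAt_of_splits_component {A T : CovObj 𝒢} (p : T.Point)
    (h : A.Splits (T.component p)) (q : T.Point) (hq : T.SameComponent p q) : A.SplitsAt T q := by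
  rcases q with ⟨v, s⟩ | ⟨e, s⟩
  · intro x g hg
    exact congrArg Subtype.val (h.1 v x g hg (⟨s, hq⟩ : T.CompV p v))
  · intro x g hg
    exact congrArg Subtype.val (h.2 e x g hg (⟨s, hq⟩ : T.CompE p e))

/-- **The Galois tower supplies the pointed Galois approximation property** under the hypotheses of
Prop. 3.6: a level `𝒢_i` of the tower is finite, pointed, has fibre-rigid and fibre-transitive
endomorphisms, and splits the given component from some `i` on ([SemiAnbd] p. 38, "cofinal").
[cite: MochizukiSemiAnbd2006, Prop 3.6 p.38] -/
theorem galoisApproxPt_of_prop36 (h36 : 𝒢.Prop36Hypotheses) : GaloisApproxPt 𝒢 := by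
  intro T hT p
  obtain ⟨i, hi⟩ := 𝒢.exists_level_splits_component h36 T hT p
  letI := SemiGraphOfAnabelioids.galoisCategory_bObj 𝒢.toAnab ⟨h36.isConnected⟩
  refine ⟨(𝒢.galoisLevelData h36).S i, 𝒢.ofBObj_isFinite _,
    ⟨Sum.inl ⟨_, (𝒢.galoisLevelData h36).x i⟩⟩, fun v x₀ σ σ' h => ?_,
    (𝒢.galoisLevelData h36).htrans i,
    fun q hq => CovObj.splitsAt_of_splits_component p (hi i le_rfl) q hq⟩
  exact 𝒢.hrigid_ofBObj_of_isConnected h36.isConnected _ (𝒢.isGalois_tower h36 i).toIsConnected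
    v x₀ σ σ' h

/-- **Homogeneity of the `𝒢_{∞,S}`** (t9's `exists_aut_apply_eq'`), in the packaged form.
[cite: MochizukiSemiAnbd2006, Prop 3.6 p.38] -/
theorem univCoverOverHomogeneous_holds : UnivCoverOverHomogeneous 𝒢 :=
  fun h𝒢 A V₀ htrans _ t t' => A.exists_aut_apply_eq' h𝒢 V₀ htrans t t'

/-- **[SemiAnbd] Proposition 3.6 (iii)** (p. 38; proof p. 39): for every `𝒢` satisfying the
hypotheses of Prop. 3.6 and every tempered fundamental group chart, `π₁^temp(𝒢)` is residually
finite — the named fact `TemperedPiResiduallyFinite`, DISCHARGED.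
[cite: MochizukiSemiAnbd2006, Prop 3.6(iii) pp.38–39] -/
theorem TemperedPiResiduallyFinite_holds :
    Literature.AnabelianGeometry.SemiGraphs.ProfiniteSemiGraph.TemperedPiResiduallyFinite.{u} :=
  temperedPiResiduallyFinite_of_galoisApproxPt (fun 𝒢 h36 => 𝒢.galoisApproxPt_of_prop36 h36)
    fun 𝒢 _ => 𝒢.univCoverOverHomogeneous_holds

end ProfiniteSemiGraph

end Literature.AnabelianGeometry.SemiGraphs
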